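import Mathlib
import HarnessLib

/-!
# Purely inseparable four-folds — PRESENTED FORM of a ledger with weights `≤ 1` (entry bookkeeping for the
# two-slot (K24a, `|r| = 3`) and C∞ (K24b, `|r| = 2`) frame files)

[OURS · counted 0 · cell `res-dim4-pi` · seat res-dim4-typ-1 g2 (K24b-FRAME half of record, p-12 g3 01:52Z /
desk g2 01:53Z).]  Pure `Finsupp` bookkeeping on `Fin 4 →₀ ℕ`, no field, no characteristic: an exceptional
ledger `r` with all weights `≤ 1` is the sum of `x_i` over its support, its support has `|r|` letters, and for
`|r| = 2` (resp. `3`) it is LITERALLY `single a 1 + single b 1` with `a ≠ b` (resp. `single κ 1 + single o 1 +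
single ν 1`, pairwise distinct) — the presented hypothesis `hr` under which res-dim4-p-1 g3's K24a frame files
(`ResCone.legal_readings_of_corner`, `…TwoSlotLegality`) and the K24b frame readings are stated, obtained from the
chain-level output «weights `≤ 1`, `|r| = 3`» of res-dim4-p-9 g3's K26a `light_weights` / its `d = 4` analogue.
Complements res-dim4-p-2 g4's `ResCone.card_support_eq_three_of_weights` (K27a), not restated here.
Nothing here proves K2(p)/K2(5) or resolution of singularities in dimension ≥ 4 / characteristic `p`.  AI kernel
work, weaker than expert review.
bears_on: LADDER-RESOLUTION:D157-DOOR2 (res-dim4-pi · K2(p) · slice B · K24a/K24b entry).  Supports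
stmt-ResolutionOfSingularities-16155 (helper).
-/

set_option linter.dupNamespace false -- mandated namespace of this single-conjunct summit

namespace Summit.ResolutionOfSingularities.ResolutionOfSingularities.Theorems.PIDim4

namespace ResCone

/-- A ledger with all weights `≤ 1` takes the value `1` exactly on its support. [folklore] -/
theorem apply_eq_one_of_mem_support_of_weights {r : Fin 4 →₀ ℕ} (h1 : ∀ i, r i ≤ 1) {i : Fin 4}
    (hi : i ∈ r.support) : r i = 1 := by
  have := h1 i
  have h0 := Finsupp.mem_support_iff.mp hi
  omega

/-- A ledger with all weights `≤ 1` is the sum of the `x_i` over its support. [folklore] -/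
theorem eq_sum_single_of_weights {r : Fin 4 →₀ ℕ} (h1 : ∀ i, r i ≤ 1) :
    r = ∑ i ∈ r.support, Finsupp.single i 1 := by
  classical
  ext j
  rw [Finsupp.finsetSum_apply]
  simp only [Finsupp.single_apply]
  rw [Finset.sum_ite_eq' r.support j (fun _ => (1 : ℕ))]
  by_cases hj : j ∈ r.support
  · rw [if_pos hj]; exact apply_eq_one_of_mem_support_of_weights h1 hj
  · rw [if_neg hj]; exact Finsupp.notMem_support_iff.mp hj

/-- A ledger with all weights `≤ 1` has exactly `|r|` boundary letters. [folklore] -/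
theorem card_support_eq_degree_of_weights {r : Fin 4 →₀ ℕ} (h1 : ∀ i, r i ≤ 1) :
    r.support.card = r.degree := by
  classical
  have hsum : r.degree = ∑ i, r i := Finsupp.degree_eq_sum _
  have hsupp : r.support = Finset.univ.filter (fun i => r i = 1) := by
    ext i
    rw [Finsupp.mem_support_iff, Finset.mem_filter]
    have := h1 i
    constructor
    · intro h; exact ⟨Finset.mem_univ i, by omega⟩
    · intro h; omega
  rw [hsupp]
  have key : ∑ i, r i = (Finset.univ.filter (fun i => r i = 1)).card := by
    rw [Finset.card_eq_sum_ones, Finset.sum_filter]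
    exact Finset.sum_congr rfl fun i _ => by have := h1 i; split_ifs with h <;> omega
  omega

/-- **Ledger (1,1) presented** (K24b entry): weights `≤ 1` and `|r| = 2` ⇒ `r = x_a x_b` for two distinct letters
`a ≠ b`. [folklore] -/
theorem exists_eq_pair_of_weights {r : Fin 4 →₀ ℕ} (h1 : ∀ i, r i ≤ 1) (hdeg : r.degree = 2) :
    ∃ a b : Fin 4, a ≠ b ∧ r = Finsupp.single a 1 + Finsupp.single b 1 := by
  classical
  have hcard : r.support.card = 2 := by rw [card_support_eq_degree_of_weights h1, hdeg]
  obtain ⟨a, b, hab, hsupp⟩ := Finset.card_eq_two.mp hcard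
  refine ⟨a, b, hab, ?_⟩
  rw [eq_sum_single_of_weights h1, hsupp, Finset.sum_pair hab]

/-- **Ledger (1,1,1) presented** (K24a entry, the `hr` of `ResCone.legal_readings_of_corner`): weights `≤ 1` and
`|r| = 3` ⇒ `r = x_κ x_o x_ν` for three pairwise distinct letters. [folklore] -/
theorem exists_eq_triple_of_weights {r : Fin 4 →₀ ℕ} (h1 : ∀ i, r i ≤ 1) (hdeg : r.degree = 3) :
    ∃ κ o ν : Fin 4, κ ≠ o ∧ κ ≠ ν ∧ o ≠ ν ∧
      r = Finsupp.single κ 1 + Finsupp.single o 1 + Finsupp.single ν 1 := by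
  classical
  have hcard : r.support.card = 3 := by rw [card_support_eq_degree_of_weights h1, hdeg]
  obtain ⟨κ, o, ν, hκo, hκν, hoν, hsupp⟩ := Finset.card_eq_three.mp hcard
  refine ⟨κ, o, ν, hκo, hκν, hoν, ?_⟩
  rw [eq_sum_single_of_weights h1, hsupp, Finset.sum_insert (by simp [hκo, hκν]), Finset.sum_pair hoν,
    add_assoc]

/-- The FOURTH letter: three pairwise distinct letters of `Fin 4` leave exactly one letter `f` outside, and every
letter is one of the four. [folklore] -/
theorem exists_fourth_letter {κ o ν : Fin 4} (hκo : κ ≠ o) (hκν : κ ≠ ν) (hoν : o ≠ ν) :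
    ∃ f : Fin 4, f ≠ κ ∧ f ≠ o ∧ f ≠ ν ∧ ∀ i : Fin 4, i = κ ∨ i = o ∨ i = ν ∨ i = f := by
  classical
  have hcard : (({κ, o, ν} : Finset (Fin 4))ᶜ).card = 1 := by
    rw [Finset.card_compl, Fintype.card_fin, Finset.card_insert_of_notMem (by simp [hκo, hκν]),
      Finset.card_pair hoν]
  obtain ⟨f, hf⟩ := Finset.card_eq_one.mp hcard
  have hfmem : f ∈ (({κ, o, ν} : Finset (Fin 4))ᶜ) := by rw [hf]; exact Finset.mem_singleton_self f
  rw [Finset.mem_compl, Finset.mem_insert, Finset.mem_insert, Finset.mem_singleton] at hfmem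
  refine ⟨f, fun h => hfmem (Or.inl h), fun h => hfmem (Or.inr (Or.inl h)),
    fun h => hfmem (Or.inr (Or.inr h)), fun i => ?_⟩
  by_cases hi : i ∈ (({κ, o, ν} : Finset (Fin 4))ᶜ)
  · rw [hf, Finset.mem_singleton] at hi; exact Or.inr (Or.inr (Or.inr hi))
  · rw [Finset.mem_compl, not_not, Finset.mem_insert, Finset.mem_insert, Finset.mem_singleton] at hi
    rcases hi with h | h | h
    · exact Or.inl h
    · exact Or.inr (Or.inl h)
    · exact Or.inr (Or.inr (Or.inl h))

/-- The two letters outside a pair: two distinct letters of `Fin 4` leave exactly two letters `f ≠ u` outside, and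
every letter is one of the four (K24b: boundary pair `λ, μ`, contact letter `f`, fourth letter `u`). [folklore] -/
theorem exists_complement_pair {a b : Fin 4} (hab : a ≠ b) :
    ∃ f u : Fin 4, f ≠ u ∧ f ≠ a ∧ f ≠ b ∧ u ≠ a ∧ u ≠ b ∧ ∀ i : Fin 4, i = a ∨ i = b ∨ i = f ∨ i = u := by
  classical
  have hcard : (({a, b} : Finset (Fin 4))ᶜ).card = 2 := by
    rw [Finset.card_compl, Fintype.card_fin, Finset.card_pair hab]
  obtain ⟨f, u, hfu, hfuset⟩ := Finset.card_eq_two.mp hcard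
  have hmem : ∀ i : Fin 4, i ∈ (({a, b} : Finset (Fin 4))ᶜ) ↔ i = f ∨ i = u := fun i => by
    rw [hfuset, Finset.mem_insert, Finset.mem_singleton]
  have hmem' : ∀ i : Fin 4, i ∈ (({a, b} : Finset (Fin 4))ᶜ) ↔ ¬ (i = a ∨ i = b) := fun i => by
    rw [Finset.mem_compl, Finset.mem_insert, Finset.mem_singleton]
  have hf := (hmem' f).mp ((hmem f).mpr (Or.inl rfl))
  have hu := (hmem' u).mp ((hmem u).mpr (Or.inr rfl))
  refine ⟨f, u, hfu, fun h => hf (Or.inl h), fun h => hf (Or.inr h), fun h => hu (Or.inl h),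
    fun h => hu (Or.inr h), fun i => ?_⟩
  by_cases hi : i = a ∨ i = b
  · rcases hi with h | h
    · exact Or.inl h
    · exact Or.inr (Or.inl h)
  · rcases (hmem i).mp ((hmem' i).mpr hi) with h | h
    · exact Or.inr (Or.inr (Or.inl h))
    · exact Or.inr (Or.inr (Or.inr h))

end ResCone

end Summit.ResolutionOfSingularities.ResolutionOfSingularities.Theorems.PIDim4
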